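import Literature.NumberTheory.Transcendental.BrownawellRedundantAuxiliary
import Mathlib.Analysis.Polynomial.MahlerMeasure
import Mathlib.Analysis.SpecialFunctions.Pow.Real
import Mathlib.Analysis.SpecialFunctions.Log.Basic
import HarnessLib

/-!
# Roy–Waldschmidt 1997, Lemme 3.8 (small integer polynomials at `θ`, by the box principle)

Fourth brick of §3 of D. Roy, M. Waldschmidt, *Approximation diophantienne et indépendance
algébrique de logarithmes*, Ann. Sci. ÉNS (4) 30 (1997), towards Théorème 3.2 (an ingredient of the
proof of their Théorème 1.1, whose corollary Théorème 0.2 is the tree's named fact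
`Literature.NumberTheory.Transcendental.royWaldschmidt_quadratic_thm_0_2`).

**Lemme 3.8** (p. 768). "Soit `θ ∈ ℂ` et soit `a ∈ ℝ` avec `0 < a < 1/2`. Alors, pour tout entier
`δ` suffisamment grand et tout nombre réel `μ ≥ δ`, il existe un polynôme non nul `P ∈ ℤ[X]` qui
vérifie `deg(P) ≤ δ`, `log M(P) ≤ μ` et `|P(θ)| ≤ exp(-aδμ)`."  PROVED as
`RoyWaldschmidt1997.lemme_3_8`, following the printed proof (Thue–Siegel / Dirichlet's box
principle with `H = ⌊e^μ/(δ+1)⌋`; here through the tree's complex box principle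
`Brownawell.exists_small_linear_forms`, and `M(P) ≤ ∑ |coefficients| ≤ (δ+1)H`), with an explicit
"suffisamment grand".  No definitions, no named facts.

## References

* [RoyWaldschmidt1997ENS] D. Roy, M. Waldschmidt, Ann. Sci. ÉNS (4) 30 (1997) 753–796, §3 (iii)
  Lemme 3.8, p. 768 (lit key paper:doi-10-1016-s0012-9593-97-89938-7, PDF p. 17).
-/

noncomputable section

open Polynomial Real Finset

namespace Literature.NumberTheory.Transcendental

namespace RoyWaldschmidt1997

/-- The integer polynomial with prescribed coefficients `p₀, …, p_δ`. [folklore] -/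
theorem exists_poly_of_coeffs (δ : ℕ) (p : Fin (δ + 1) → ℤ) :
    ∃ P : ℤ[X], P.natDegree ≤ δ ∧ (∀ i : Fin (δ + 1), P.coeff i = p i) ∧
      (∀ n, δ < n → P.coeff n = 0) ∧ ∀ θ : ℂ, aeval θ P = ∑ i : Fin (δ + 1), (p i : ℂ) * θ ^ (i : ℕ) := by
  classical
  refine ⟨∑ i : Fin (δ + 1), monomial (i : ℕ) (p i), ?_, ?_, ?_, ?_⟩
  · refine natDegree_sum_le_of_forall_le _ _ fun i _ => ?_
    exact (natDegree_monomial_le _).trans (Nat.lt_succ_iff.mp i.isLt)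
  · intro i
    rw [finsetSum_coeff]
    simp only [coeff_monomial]
    rw [Finset.sum_eq_single i]
    · simp
    · intro j _ hji
      rw [if_neg]
      exact fun h => hji (Fin.ext h)
    · simp
  · intro n hn
    rw [finsetSum_coeff]
    refine Finset.sum_eq_zero fun i _ => ?_
    rw [coeff_monomial, if_neg]
    have := i.isLt; omega
  · intro θ
    simp [map_sum, aeval_monomial, mul_comm]

/-- The growth inequality behind Lemme 3.8: for `0 < a < 1/2`, `c = 1 - 2a`, `L ≥ 0` and
`δ` large (explicitly, in terms of `L`), `μ ≥ δ`:
`log 64 + 2δL + (δ+1) log(δ+1) + 2aδμ < μ(δ-1)`. [folklore] -/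
theorem lemme_3_8_key {a L δ μ : ℝ} (ha0 : 0 < a) (ha : a < 1 / 2)
    (hδA : 4 * (2 * L + 2 + Real.log 64) / (3 * (1 - 2 * a)) ≤ δ)
    (hδB : (32 / (1 - 2 * a)) ^ 2 ≤ δ) (hδ1 : 1 ≤ δ) (hμ : δ ≤ μ) :
    Real.log 64 + 2 * δ * L + (δ + 1) * Real.log (δ + 1) + 2 * a * δ * μ < μ * (δ - 1) := by
  set c : ℝ := 1 - 2 * a with hc
  have hcpos : 0 < c := by rw [hc]; linarith
  have hδ1pos : (0 : ℝ) < δ + 1 := by linarith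
  -- `(δ+1) log(δ+1) ≤ c δ² / 4`
  have h1 : (δ + 1) * Real.log (δ + 1) ≤ c * δ ^ 2 / 4 := by
    -- `log x ≤ 2 √x` (cf. the tree's `DFI1995.log_le_two_mul_sqrt`, not imported here)
    have hs : Real.log (δ + 1) ≤ 2 * Real.sqrt (δ + 1) := by
      have h := Real.log_le_rpow_div hδ1pos.le (by norm_num : (0 : ℝ) < 1 / 2)
      rw [Real.sqrt_eq_rpow]
      linarith [h, show (δ + 1) ^ (1 / 2 : ℝ) / (1 / 2) = 2 * (δ + 1) ^ (1 / 2 : ℝ) by ring]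
    set u : ℝ := Real.sqrt (δ + 1) with hu
    have hu2 : u ^ 2 = δ + 1 := Real.sq_sqrt hδ1pos.le
    have hsq : 32 / c ≤ u := by
      rw [hu, Real.le_sqrt (by positivity) hδ1pos.le]; linarith
    have hupos : 0 < u := Real.sqrt_pos.mpr hδ1pos
    have hcu : 2 ≤ (c / 16) * u := by
      have := mul_le_mul_of_nonneg_left hsq (by positivity : (0 : ℝ) ≤ c / 16)
      rwa [show c / 16 * (32 / c) = 2 by field_simp; ring] at this
    have hsq4 : (δ + 1) ^ 2 ≤ 4 * δ ^ 2 := by nlinarith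
    calc (δ + 1) * Real.log (δ + 1) ≤ (δ + 1) * (2 * u) := mul_le_mul_of_nonneg_left hs hδ1pos.le
      _ = 2 * u ^ 3 := by rw [← hu2]; ring
      _ ≤ ((c / 16) * u) * u ^ 3 := by nlinarith [pow_pos hupos 3]
      _ = (c / 16) * (u ^ 2) ^ 2 := by ring
      _ = (c / 16) * (δ + 1) ^ 2 := by rw [hu2]
      _ ≤ (c / 16) * (4 * δ ^ 2) := mul_le_mul_of_nonneg_left hsq4 (by positivity)
      _ = c * δ ^ 2 / 4 := by ring
  -- `log 64 + 2δL + δ < (3/4) c δ²`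
  have h2 : Real.log 64 + 2 * δ * L + δ < 3 * c * δ ^ 2 / 4 := by
    have h64 : 0 ≤ Real.log 64 := Real.log_nonneg (by norm_num)
    have h3c : 0 < 3 * c := by positivity
    have : (2 * L + 2 + Real.log 64) * δ ≤ 3 * c * δ ^ 2 / 4 := by
      have h := mul_le_mul_of_nonneg_right hδA (by linarith : (0 : ℝ) ≤ δ)
      rw [div_mul_eq_mul_div, div_le_iff₀ h3c] at h
      nlinarith
    nlinarith
  -- `μ (cδ - 1) ≥ δ (cδ - 1)`
  have h3 : δ * (c * δ - 1) ≤ μ * (c * δ - 1) := by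
    have h32 : (1 : ℝ) ≤ 32 / c := by
      rw [le_div_iff₀ hcpos, hc]; linarith
    have hδ32 : 32 / c ≤ δ := by nlinarith
    have : 0 ≤ c * δ - 1 := by
      have := mul_le_mul_of_nonneg_left hδ32 hcpos.le
      rw [show c * (32 / c) = 32 by field_simp] at this
      linarith
    exact mul_le_mul_of_nonneg_right hμ this
  have e : μ * (δ - 1) = μ * (c * δ - 1) + 2 * a * δ * μ := by rw [hc]; ring
  rw [e]
  nlinarith

/-- The counting inequality of the box principle in Lemme 3.8. [folklore] -/
theorem lemme_3_8_count {δ H : ℕ} {a μ A E prec : ℝ} (ha0 : 0 < a) (hμpos : 0 < μ) (hA1 : 1 ≤ A)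
    (hE1 : 1 ≤ E) (hEpos : 0 < E) (hδ1 : 1 ≤ δ) (hprec : prec = Real.exp (-(a * δ * μ)) / 2)
    (hHle : ((δ : ℝ) + 1) * H ≤ E) (hHge : E / (δ + 1) ≤ (H : ℝ) + 1)
    (hexp : 64 * A ^ 2 * Real.exp (2 * a * δ * μ) * ((δ : ℝ) + 1) ^ (δ + 1) < E ^ (δ - 1)) :
    ((2 * ⌈((δ + 1 : ℕ) : ℝ) * H * A / prec⌉₊ + 2) ^ 2) < (H + 1) ^ (δ + 1) := by
  have hδ1pos : (0 : ℝ) < δ + 1 := by positivity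
  have hprecpos : 0 < prec := by rw [hprec]; positivity
  have hlhs : (((2 * ⌈((δ + 1 : ℕ) : ℝ) * H * A / prec⌉₊ + 2) ^ 2 : ℕ) : ℝ) ≤
      64 * A ^ 2 * Real.exp (2 * a * δ * μ) * E ^ 2 := by
    set K : ℕ := ⌈((δ + 1 : ℕ) : ℝ) * H * A / prec⌉₊ with hK
    set Y : ℝ := E * A * Real.exp (a * δ * μ) with hY
    have hY1 : 1 ≤ Y := by
      have h3 : 1 ≤ Real.exp (a * δ * μ) := Real.one_le_exp (by positivity)
      calc (1 : ℝ) = 1 * 1 * 1 := by ring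
        _ ≤ E * A * Real.exp (a * δ * μ) :=
          mul_le_mul (mul_le_mul hE1 hA1 zero_le_one hEpos.le) h3 zero_le_one (by positivity)
    have hAp : A / prec = 2 * A * Real.exp (a * δ * μ) := by
      rw [hprec, Real.exp_neg]; field_simp
    have hX : ((δ + 1 : ℕ) : ℝ) * H * A / prec ≤ 2 * Y := by
      have h1 : ((δ + 1 : ℕ) : ℝ) * H ≤ E := by push_cast; exact hHle
      calc ((δ + 1 : ℕ) : ℝ) * H * A / prec = (((δ + 1 : ℕ) : ℝ) * H) * (A / prec) := by ring
        _ ≤ E * (A / prec) := mul_le_mul_of_nonneg_right h1 (by positivity)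
        _ = 2 * Y := by rw [hAp, hY]; ring
    have hKle : (K : ℝ) ≤ 2 * Y + 1 := by
      have := (Nat.ceil_lt_add_one (by positivity : (0 : ℝ) ≤ ((δ + 1 : ℕ) : ℝ) * H * A / prec)).le
      rw [← hK] at this; linarith
    have hlin : (2 * (K : ℝ) + 2) ≤ 8 * Y := by linarith
    push_cast
    calc ((2 : ℝ) * K + 2) ^ 2 ≤ (8 * Y) ^ 2 := pow_le_pow_left₀ (by positivity) hlin 2
      _ = 64 * A ^ 2 * Real.exp (2 * a * δ * μ) * E ^ 2 := by
          rw [hY, show 2 * a * δ * μ = a * δ * μ + a * δ * μ by ring, Real.exp_add]; ring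
  have hrhs : E ^ (δ + 1) / ((δ : ℝ) + 1) ^ (δ + 1) ≤ (((H + 1) ^ (δ + 1) : ℕ) : ℝ) := by
    push_cast
    rw [← div_pow]
    exact pow_le_pow_left₀ (by positivity) hHge _
  have hmid : 64 * A ^ 2 * Real.exp (2 * a * δ * μ) * E ^ 2 < E ^ (δ + 1) / ((δ : ℝ) + 1) ^ (δ + 1) := by
    have hdpos : (0 : ℝ) < ((δ : ℝ) + 1) ^ (δ + 1) := pow_pos hδ1pos _
    rw [lt_div_iff₀ hdpos]
    have e : E ^ (δ + 1) = E ^ (δ - 1) * E ^ 2 := by rw [← pow_add]; congr 1; omega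
    rw [e]
    calc 64 * A ^ 2 * Real.exp (2 * a * δ * μ) * E ^ 2 * ((δ : ℝ) + 1) ^ (δ + 1)
        = (64 * A ^ 2 * Real.exp (2 * a * δ * μ) * ((δ : ℝ) + 1) ^ (δ + 1)) * E ^ 2 := by ring
      _ < E ^ (δ - 1) * E ^ 2 := mul_lt_mul_of_pos_right hexp (by positivity)
  exact_mod_cast hlhs.trans_lt (hmid.trans_le hrhs)

/-- **Roy–Waldschmidt 1997, Lemme 3.8.**  For `θ ∈ ℂ` and `0 < a < 1/2`, for every sufficiently
large integer `δ` and every real `μ ≥ δ` there is a non-zero `P ∈ ℤ[X]` with `deg P ≤ δ`,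
`log M(P) ≤ μ` and `|P(θ)| ≤ e^{-aδμ}`.
[cite: RoyWaldschmidt1997ENS, §3 (iii) Lemme 3.8, p. 768] -/
theorem lemme_3_8 (θ : ℂ) {a : ℝ} (ha0 : 0 < a) (ha : a < 1 / 2) :
    ∃ δ₀ : ℕ, ∀ δ : ℕ, δ₀ ≤ δ → ∀ μ : ℝ, (δ : ℝ) ≤ μ →
      ∃ P : ℤ[X], P ≠ 0 ∧ P.natDegree ≤ δ ∧
        Real.log (P.map (Int.castRingHom ℂ)).mahlerMeasure ≤ μ ∧
        ‖aeval θ P‖ ≤ Real.exp (-(a * δ * μ)) := by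
  classical
  -- constants
  set A₀ : ℝ := max 1 ‖θ‖ with hA₀
  have hA₀1 : 1 ≤ A₀ := le_max_left _ _
  have hA₀pos : 0 < A₀ := one_pos.trans_le hA₀1
  set L : ℝ := Real.log A₀ with hL
  have hL0 : 0 ≤ L := Real.log_nonneg hA₀1
  set c : ℝ := 1 - 2 * a with hc
  have hcpos : 0 < c := by rw [hc]; linarith
  -- the threshold
  refine ⟨max (max ⌈4 * (2 * L + 2 + Real.log 64) / (3 * c)⌉₊ ⌈(32 / c) ^ 2⌉₊) 2, ?_⟩
  intro δ hδ μ hμ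
  have hδ2 : (2 : ℝ) ≤ δ := by exact_mod_cast (le_max_right _ _).trans hδ
  have hδ1 : (1 : ℝ) ≤ δ := by linarith
  have hδA : 4 * (2 * L + 2 + Real.log 64) / (3 * c) ≤ δ :=
    (Nat.le_ceil _).trans (by exact_mod_cast ((le_max_left _ _).trans (le_max_left _ _)).trans hδ)
  have hδB : (32 / c) ^ 2 ≤ δ :=
    (Nat.le_ceil _).trans (by exact_mod_cast ((le_max_right _ _).trans (le_max_left _ _)).trans hδ)
  have hμpos : 0 < μ := by linarith
  -- parameters of the box principle
  set E : ℝ := Real.exp μ with hE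
  have hEpos : 0 < E := Real.exp_pos μ
  have hE1 : 1 ≤ E := Real.one_le_exp hμpos.le
  have hδ1pos : (0 : ℝ) < δ + 1 := by linarith
  -- `H = ⌊e^μ/(δ+1)⌋`, kept opaque
  obtain ⟨H, hHle, hHge⟩ : ∃ H : ℕ, ((δ : ℝ) + 1) * H ≤ E ∧ E / (δ + 1) ≤ (H : ℝ) + 1 := by
    refine ⟨⌊E / (δ + 1)⌋₊, ?_, (Nat.lt_floor_add_one _).le⟩
    have := Nat.floor_le (div_nonneg hEpos.le hδ1pos.le) (a := E / (δ + 1))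
    calc ((δ : ℝ) + 1) * ⌊E / (δ + 1)⌋₊ ≤ (δ + 1) * (E / (δ + 1)) := mul_le_mul_of_nonneg_left this hδ1pos.le
      _ = E := by field_simp
  set A : ℝ := A₀ ^ δ with hA
  have hA1 : 1 ≤ A := one_le_pow₀ hA₀1
  set prec : ℝ := Real.exp (-(a * δ * μ)) / 2 with hprec_def
  have hprecpos : 0 < prec := by positivity
  have hcoef : ∀ (_ν : Fin 1) (i : Fin (δ + 1)), ‖θ ^ (i : ℕ)‖ ≤ A := by
    intro _ i
    rw [norm_pow]
    calc ‖θ‖ ^ (i : ℕ) ≤ A₀ ^ (i : ℕ) := pow_le_pow_left₀ (norm_nonneg _) (le_max_right _ _) _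
      _ ≤ A₀ ^ δ := pow_le_pow_right₀ hA₀1 (Nat.lt_succ_iff.mp i.isLt)
  -- the counting condition
  have hcount : ((2 * ⌈(Fintype.card (Fin (δ + 1)) : ℝ) * H * A / prec⌉₊ + 2) ^ 2) ^
      Fintype.card (Fin 1) < (H + 1) ^ Fintype.card (Fin (δ + 1)) := by
    rw [Fintype.card_fin, Fintype.card_fin, pow_one]
    have key : Real.log 64 + 2 * δ * L + (δ + 1) * Real.log (δ + 1) + 2 * a * δ * μ < μ * (δ - 1) :=
      lemme_3_8_key ha0 ha hδA hδB hδ1 hμ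
    have hexp : 64 * A ^ 2 * Real.exp (2 * a * δ * μ) * ((δ : ℝ) + 1) ^ (δ + 1) < E ^ (δ - 1) := by
      have hA' : A = Real.exp (δ * L) := by
        rw [hA, hL, ← Real.exp_log (pow_pos hA₀pos δ), Real.log_pow]
      have h64 : (64 : ℝ) = Real.exp (Real.log 64) := (Real.exp_log (by norm_num)).symm
      have hd : ((δ : ℝ) + 1) ^ (δ + 1) = Real.exp ((δ + 1) * Real.log (δ + 1)) := by
        rw [← Real.exp_log (pow_pos hδ1pos (δ + 1)), Real.log_pow]; push_cast; ring_nf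
      have hδnat : 1 ≤ δ := by exact_mod_cast hδ1
      have hEd : E ^ (δ - 1) = Real.exp (μ * (δ - 1)) := by
        rw [hE, ← Real.exp_nat_mul]; congr 1
        push_cast [Nat.cast_sub hδnat]; ring
      rw [hA', h64, hd, hEd, sq, ← Real.exp_add, ← Real.exp_add, ← Real.exp_add, ← Real.exp_add,
        Real.exp_lt_exp]
      linarith
    have hδnat : 1 ≤ δ := by exact_mod_cast hδ1
    exact lemme_3_8_count ha0 hμpos hA1 hE1 hEpos hδnat hprec_def hHle hHge hexp
  -- the box principle
  obtain ⟨p, hp0, hpH, hpsmall⟩ := Brownawell.exists_small_linear_forms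
    (fun (_ : Fin 1) (i : Fin (δ + 1)) => θ ^ (i : ℕ)) hcoef hprecpos H hcount
  obtain ⟨P, hPdeg, hPcoeff, hPcoeff', hPeval⟩ := exists_poly_of_coeffs δ p
  have hP0 : P ≠ 0 := by
    intro h0
    apply hp0
    funext i
    have := hPcoeff i
    rw [h0, coeff_zero] at this
    exact this.symm
  refine ⟨P, hP0, hPdeg, ?_, ?_⟩
  · -- Mahler measure
    have hM := mahlerMeasure_le_sum_norm_coeff (P.map (Int.castRingHom ℂ))
    have hsum : ((P.map (Int.castRingHom ℂ)).sum fun _ b => ‖b‖) ≤ ((δ : ℝ) + 1) * H := by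
      rw [Polynomial.sum_def]
      have hsupp : (P.map (Int.castRingHom ℂ)).support ⊆ Finset.range (δ + 1) := by
        intro k hk
        rw [Finset.mem_range]
        by_contra hk'
        push Not at hk'
        have : (P.map (Int.castRingHom ℂ)).coeff k = 0 := by
          rw [coeff_map, hPcoeff' k (by omega), map_zero]
        exact (mem_support_iff.mp hk) this
      calc ∑ k ∈ (P.map (Int.castRingHom ℂ)).support, ‖(P.map (Int.castRingHom ℂ)).coeff k‖
          ≤ ∑ k ∈ Finset.range (δ + 1), ‖(P.map (Int.castRingHom ℂ)).coeff k‖ :=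
            Finset.sum_le_sum_of_subset_of_nonneg hsupp fun _ _ _ => norm_nonneg _
        _ ≤ ∑ _k ∈ Finset.range (δ + 1), (H : ℝ) := Finset.sum_le_sum fun k hk => by
            rw [coeff_map, eq_intCast, Complex.norm_intCast]
            have hk' : k < δ + 1 := Finset.mem_range.mp hk
            have := hpH ⟨k, hk'⟩
            rw [← hPcoeff ⟨k, hk'⟩] at this
            exact_mod_cast this
        _ = ((δ : ℝ) + 1) * H := by rw [Finset.sum_const, Finset.card_range, nsmul_eq_mul]; push_cast; ring
    have hMpos : 0 < (P.map (Int.castRingHom ℂ)).mahlerMeasure :=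
      mahlerMeasure_pos_of_ne_zero ((Polynomial.map_ne_zero_iff (RingHom.injective_int _)).mpr hP0)
    calc Real.log (P.map (Int.castRingHom ℂ)).mahlerMeasure ≤ Real.log E :=
          Real.log_le_log hMpos (hM.trans (hsum.trans hHle))
      _ = μ := Real.log_exp μ
  · -- smallness
    rw [hPeval θ]
    have := hpsmall 0
    calc ‖∑ i : Fin (δ + 1), (p i : ℂ) * θ ^ (i : ℕ)‖ ≤ 2 * prec := this
      _ = Real.exp (-(a * δ * μ)) := by rw [hprec_def]; ring

end RoyWaldschmidt1997

end Literature.NumberTheory.Transcendental
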